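import Mathlib
import Summits.Ventures.HodgeRepro.Tier4.Target
import Summits.Ventures.HodgeRepro.Tier4.Common.TargetData
import Summits.Ventures.HodgeRepro.Tier4.Common.TargetBall
import Summits.Ventures.HodgeRepro.Tier4.Common.AutForms
import Summits.Ventures.HodgeRepro.Tier4.Common.HeckeOnForms
import Summits.Ventures.HodgeRepro.Tier4.Common.HeckeInvariance
import Summits.Ventures.HodgeRepro.Tier4.Common.BallBounds
import Summits.Ventures.HodgeRepro.Tier4.Common.FixedSetNull

/-!
# Tier4/Common/FundamentalDomain — every level `Γ′` of the frozen target has a measurable fundamental domain in the ball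

Blind re-derivation cell `pub-hodge-repro`, Tier 4 «prove the step» (README §9–§10), seat t4-L4-p1 (prover, LINE L4,
gen 0; lead's assignment S12161 (3) = the skeleton's `exists_domain`, shared module announced S12255 — every line's
conclusion quantifies `∃ D, IsFundamentalDomainFor (ballActions τ₀ C Γ′) D`).  Tree path
`lean/Summits/Ventures/HodgeRepro/Tier4/Common/FundamentalDomain.lean`.  No literature input: the theorem is the
DISCRETENESS of the arithmetic group `Γ′ ⊆ U(H)(𝒪_E)` in `U(2,1)` (from the definite places, H3 of the frozen target) plus
a Borel transversal, all on the target's own objects.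

WHAT IS PROVED.  `TargetData.exists_domain d Γ' hΓ' : ∃ D, d.IsDomain Γ' D` for every level `Γ′` (`d.IsLevel Γ'`):
* `finite_bounded_part` (**discreteness**): only finitely many `γ ∈ Γ` have a ball matrix `toBallMat τ₀ C γ` with entries
  `≤ K`.  Every entry of `γ` is an algebraic integer (`principalCongruence`); at each embedding `τ ≠ τ₀, τ̄₀` the matrix
  `τ(γ)` preserves the DEFINITE form `τ(H)` (`hdef`), so its entries are bounded (`exists_bound_of_isDefinite`); at `τ₀`
  they are bounded through `τ₀(γ) = C · M(γ) · C⁻¹`.  All conjugates bounded ⟹ finitely many values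
  (`NumberField.Embeddings.finite_of_norm_le`).
* `finite_nsq_le` (**proper discontinuity**): for `z` in the ball, finitely many `γ ∈ Γ′` satisfy `nsq (γ·z) ≤ nsq z`
  (`norm_entry_le_of_mem_ball` + discreteness).
* `dom d Γ'` (**the Borel transversal**): the points of the ball that are lexicographically least in their `Γ′`-orbit for
  the key `(nsq z, Re z₀, Im z₀, Re z₁, Im z₁)`; measurable (`measurableSet_dom`: a countable intersection, `Γ′` countable
  as `E` is a number field); every orbit has a least element (`exists_act_mem_dom`: the orbit points with `nsq ≤ nsq z`
  are finitely many); two points of `dom` in one orbit coincide (`eq_of_mem_dom_of_act`).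
* `volume_image_inter_image` (**almost-disjointness**): for two DIFFERENT actions `act γ₁ ≠ act γ₂` of `Γ′`,
  `act γ₁ '' dom ∩ act γ₂ '' dom ⊆ act γ₁ '' Fix(γ₂⁻¹γ₁)` with the fixed set null (`volume_fixed_null`; the ball matrix of
  `γ₂⁻¹γ₁` is not scalar, else the two actions coincide — `act_eq_of_scalar`) and the image of a null set under a
  holomorphic map null (`addHaar_image_eq_zero_of_differentiableOn_of_addHaar_eq_zero`).
* `exists_fundamentalDomain`: `IsFundamentalDomainFor (ballActions d.τ₀ d.C Γ') (dom d Γ')` — the four clauses of the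
  frozen definition (Target.lean L175–L178).

NOT proved here (and not needed for `exists_domain`): compactness / relative compactness of the quotient (Godement); the
lit-facing `BorelHarishChandra1962_Thm11_8_fundamentalDomain_hdef` of `Tier4/LitCompactness.lean` asks more.
HC_CM is NOT proved by anyone in this repository.
-/

set_option autoImplicit false

noncomputable section

open Matrix Metric NumberField MeasureTheory
open scoped ComplexConjugate ComplexOrder Pointwise

namespace Summit.Ventures.HodgeRepro.Tier4

/-! ## B″. Finiteness of the bounded part of `Γ` (discreteness of the arithmetic group) -/

section Arithmetic

variable {F E : Type} [Field F] [NumberField F] [IsGalois ℚ F] [IsCMField F]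
  [Field E] [NumberField E] [IsGalois ℚ E] [IsCMField E] (d : TargetData F E)

/-- Every entry of an element of `Γ` is an algebraic integer. -/
theorem isIntegral_of_mem {γ : Matrix (Fin 3) (Fin 3) E} (hγ : γ ∈ d.Γ) (i j : Fin 3) : IsIntegral ℤ (γ i j) :=
  (d.hΓ.2.2.2.1 hγ).2.1 i j

/-- At every embedding `τ`, `τ(γ)` preserves `τ(H)` for `γ ∈ U(H)`. -/
theorem map_conjTranspose_mul_map (τ : E →+* ℂ) {γ : Matrix (Fin 3) (Fin 3) E}
    (hγ : IsUnitaryOf (conjE E) d.H γ) : (γ.map τ)ᴴ * d.H.map τ * γ.map τ = d.H.map τ := by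
  rw [conjTranspose_map τ (conjE E) (complexConj_intertwines E τ), ← Matrix.map_mul, ← Matrix.map_mul]
  unfold IsUnitaryOf at hγ
  rw [hγ]

/-- At a definite embedding, the entries of `τ(γ)`, `γ ∈ Γ`, are bounded by a constant depending only on `τ(H)`. -/
theorem exists_bound_at_definite (τ : E →+* ℂ) (hτ : IsDefinite (d.H.map τ)) :
    ∃ B : ℝ, ∀ γ ∈ d.Γ, ∀ i j, ‖τ (γ i j)‖ ≤ B := by
  obtain ⟨B, hB⟩ := exists_bound_of_isDefinite hτ
  refine ⟨B, fun γ hγ i j => ?_⟩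
  have := hB _ (map_conjTranspose_mul_map d τ (d.isUnitaryOf_of_mem hγ)) i j
  simpa [Matrix.map_apply] using this

/-- `τ₀(γ) = C · M(γ) · C⁻¹`. -/
theorem map_τ₀_eq (γ : Matrix (Fin 3) (Fin 3) E) :
    γ.map d.τ₀ = d.C * toBallMat d.τ₀ d.C γ * d.C⁻¹ := by
  have hdet : IsUnit d.C.det := (Matrix.isUnit_iff_isUnit_det d.C).mp d.hC.1
  have hCC : d.C * d.C⁻¹ = 1 := Matrix.mul_nonsing_inv d.C hdet
  unfold toBallMat
  calc γ.map d.τ₀ = (d.C * d.C⁻¹) * γ.map d.τ₀ * (d.C * d.C⁻¹) := by rw [hCC, Matrix.one_mul, Matrix.mul_one]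
    _ = d.C * (d.C⁻¹ * γ.map d.τ₀ * d.C) * d.C⁻¹ := by simp only [Matrix.mul_assoc]

/-- At `τ₀`, a bound on the ball matrix bounds `τ₀(γ)`. -/
theorem norm_τ₀_le {γ : Matrix (Fin 3) (Fin 3) E} {K : ℝ} (hK : ∀ i j, ‖toBallMat d.τ₀ d.C γ i j‖ ≤ K) (i j : Fin 3) :
    ‖d.τ₀ (γ i j)‖ ≤ 3 * (9 * (3 * (cnorm d.C * (9 * K))) * cnorm d.C⁻¹) := by
  have h1 : ‖d.τ₀ (γ i j)‖ = ‖(d.C * toBallMat d.τ₀ d.C γ * d.C⁻¹) i j‖ := by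
    rw [← map_τ₀_eq, Matrix.map_apply]
  rw [h1]
  refine (norm_mul_apply_le _ _ i j).trans ?_
  have h2 : cnorm (d.C * toBallMat d.τ₀ d.C γ) ≤ 9 * (3 * (cnorm d.C * (9 * K))) := by
    refine cnorm_le_of_forall fun a b => (norm_mul_apply_le _ _ a b).trans ?_
    have h3 : cnorm (toBallMat d.τ₀ d.C γ) ≤ 9 * K := cnorm_le_of_forall hK
    have h4 : 0 ≤ cnorm d.C := cnorm_nonneg _
    gcongr
  have h5 : 0 ≤ cnorm d.C⁻¹ := cnorm_nonneg _
  gcongr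

omit [NumberField E] [IsGalois ℚ E] [IsCMField E] in
/-- The conjugate embedding has the same norms. -/
theorem norm_conjEmb_apply (τ : E →+* ℂ) (x : E) : ‖conjEmb τ x‖ = ‖τ x‖ := by
  rw [conjEmb, RingHom.comp_apply, Complex.norm_conj]

/-- **All conjugates of all entries are bounded** on the bounded part of `Γ`: for every `K` there is `B` with
`‖φ (γ i j)‖ ≤ B` for every embedding `φ`, every `γ ∈ Γ` whose ball matrix has entries `≤ K`, and all `i, j`. -/
theorem exists_bound_all_embeddings (K : ℝ) :
    ∃ B : ℝ, ∀ γ ∈ d.Γ, (∀ i j, ‖toBallMat d.τ₀ d.C γ i j‖ ≤ K) → ∀ φ : E →+* ℂ, ∀ i j, ‖φ (γ i j)‖ ≤ B := by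
  have hτ : ∀ φ : E →+* ℂ, ∃ B : ℝ, ∀ γ ∈ d.Γ, (∀ i j, ‖toBallMat d.τ₀ d.C γ i j‖ ≤ K) →
      ∀ i j, ‖φ (γ i j)‖ ≤ B := by
    intro φ
    by_cases h0 : φ = d.τ₀
    · subst h0
      exact ⟨_, fun γ _ hK i j => norm_τ₀_le d hK i j⟩
    by_cases h1 : φ = conjEmb d.τ₀
    · subst h1
      exact ⟨_, fun γ _ hK i j => by rw [norm_conjEmb_apply]; exact norm_τ₀_le d hK i j⟩
    obtain ⟨B, hB⟩ := exists_bound_at_definite d φ (d.hdef φ h0 h1)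
    exact ⟨B, fun γ hγ _ i j => hB γ hγ i j⟩
  choose Bd hBd using hτ
  refine ⟨∑ φ : E →+* ℂ, |Bd φ|, fun γ hγ hK φ i j => (hBd φ γ hγ hK i j).trans ?_⟩
  calc Bd φ ≤ |Bd φ| := le_abs_self _
    _ ≤ ∑ ψ : E →+* ℂ, |Bd ψ| :=
        Finset.single_le_sum (f := fun ψ => |Bd ψ|) (fun ψ _ => abs_nonneg _) (Finset.mem_univ φ)

/-- **Discreteness of the arithmetic group**: only finitely many `γ ∈ Γ` have a ball matrix with entries `≤ K`. -/
theorem finite_bounded_part (K : ℝ) :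
    {γ : Matrix (Fin 3) (Fin 3) E | γ ∈ d.Γ ∧ ∀ i j, ‖toBallMat d.τ₀ d.C γ i j‖ ≤ K}.Finite := by
  obtain ⟨B, hB⟩ := exists_bound_all_embeddings d K
  set S : Set E := {x : E | IsIntegral ℤ x ∧ ∀ φ : E →+* ℂ, ‖φ x‖ ≤ B} with hS
  have hSfin : S.Finite := NumberField.Embeddings.finite_of_norm_le E ℂ B
  have hpi : (Set.univ.pi fun _ : Fin 3 => Set.univ.pi fun _ : Fin 3 => S).Finite :=
    Set.Finite.pi fun _ => Set.Finite.pi fun _ => hSfin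
  refine hpi.subset fun γ ⟨hγ, hK⟩ => ?_
  rw [Set.mem_univ_pi]
  intro i
  rw [Set.mem_univ_pi]
  intro j
  exact ⟨isIntegral_of_mem d hγ i j, fun φ => hB γ hγ hK φ i j⟩

end Arithmetic

/-- A number field is countable. -/
theorem countable_of_numberField (K : Type) [Field K] [NumberField K] : Countable K := by
  have b := Module.finBasis ℚ K
  exact b.equivFun.injective.countable

section Countable

variable {F E : Type} [Field F] [NumberField F] [IsGalois ℚ F] [IsCMField F]
  [Field E] [NumberField E] [IsGalois ℚ E] [IsCMField E] (d : TargetData F E)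

/-- `Γ` (hence every level) is a countable set. -/
theorem countable_Γ : (d.Γ : Set (Matrix (Fin 3) (Fin 3) E)).Countable := by
  haveI : Countable E := countable_of_numberField E
  haveI : Countable (Matrix (Fin 3) (Fin 3) E) := inferInstanceAs (Countable (Fin 3 → Fin 3 → E))
  exact Set.to_countable _

end Countable

/-! ## D. The Borel transversal: the lexicographically least point of each orbit -/

section Key

/-- The lexicographic key `(nsq z, Re z₀, Im z₀, Re z₁, Im z₁)` of a point of `ℂ²`. -/
def key (z : Fin 2 → ℂ) : ℝ ×ₗ (ℝ ×ₗ (ℝ ×ₗ (ℝ ×ₗ ℝ))) :=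
  toLex (nsq z, toLex ((z 0).re, toLex ((z 0).im, toLex ((z 1).re, (z 1).im))))

/-- The key determines the point. -/
theorem key_injective : Function.Injective key := by
  intro z w h
  simp only [key, toLex_inj, Prod.mk.injEq] at h
  obtain ⟨_, h0r, h0i, h1r, h1i⟩ := h
  funext j
  fin_cases j
  · exact Complex.ext h0r h0i
  · exact Complex.ext h1r h1i

/-- `key z < key w` when `nsq z < nsq w`. -/
theorem key_lt_of_nsq_lt {z w : Fin 2 → ℂ} (h : nsq z < nsq w) : key z < key w := by
  simp only [key, Prod.Lex.toLex_lt_toLex]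
  exact Or.inl h

/-- `key z ≤ key w` forces `nsq z ≤ nsq w`. -/
theorem nsq_le_of_key_le {z w : Fin 2 → ℂ} (h : key z ≤ key w) : nsq z ≤ nsq w := by
  simp only [key, Prod.Lex.toLex_le_toLex] at h
  rcases h with h | ⟨h, _⟩
  · exact h.le
  · exact h.le

/-- The key comparison, unfolded. -/
theorem key_le_iff (z w : Fin 2 → ℂ) :
    key z ≤ key w ↔ nsq z < nsq w ∨ nsq z = nsq w ∧ ((z 0).re < (w 0).re ∨ (z 0).re = (w 0).re ∧
      ((z 0).im < (w 0).im ∨ (z 0).im = (w 0).im ∧ ((z 1).re < (w 1).re ∨ (z 1).re = (w 1).re ∧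
        (z 1).im ≤ (w 1).im))) := by
  simp only [key, Prod.Lex.toLex_le_toLex]

/-- The set `{z | key z ≤ key (f z)}` is measurable for measurable `f`. -/
theorem measurableSet_key_le {f : (Fin 2 → ℂ) → (Fin 2 → ℂ)} (hf : Measurable f) :
    MeasurableSet {z | key z ≤ key (f z)} := by
  have hnsq : Measurable nsq := continuous_nsq.measurable
  have h0r : Measurable fun z : Fin 2 → ℂ => (z 0).re := Complex.measurable_re.comp (measurable_pi_apply 0)
  have h0i : Measurable fun z : Fin 2 → ℂ => (z 0).im := Complex.measurable_im.comp (measurable_pi_apply 0)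
  have h1r : Measurable fun z : Fin 2 → ℂ => (z 1).re := Complex.measurable_re.comp (measurable_pi_apply 1)
  have h1i : Measurable fun z : Fin 2 → ℂ => (z 1).im := Complex.measurable_im.comp (measurable_pi_apply 1)
  simp only [key_le_iff]
  refine (measurableSet_lt hnsq (hnsq.comp hf)).union ((measurableSet_eq_fun hnsq (hnsq.comp hf)).inter ?_)
  refine (measurableSet_lt h0r (h0r.comp hf)).union ((measurableSet_eq_fun h0r (h0r.comp hf)).inter ?_)
  refine (measurableSet_lt h0i (h0i.comp hf)).union ((measurableSet_eq_fun h0i (h0i.comp hf)).inter ?_)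
  refine (measurableSet_lt h1r (h1r.comp hf)).union ((measurableSet_eq_fun h1r (h1r.comp hf)).inter ?_)
  exact measurableSet_le h1i (h1i.comp hf)

end Key

section Transversal

variable {F E : Type} [Field F] [NumberField F] [IsGalois ℚ F] [IsCMField F]
  [Field E] [NumberField E] [IsGalois ℚ E] [IsCMField E] (d : TargetData F E)

/-- The action of any matrix is a measurable self-map of `ℂ²`. -/
theorem measurable_act (γ : Matrix (Fin 3) (Fin 3) E) : Measurable (d.act γ) := by
  unfold TargetData.act actM
  refine measurable_pi_iff.2 fun k => ?_
  have h1 : ∀ i : Fin 3, Measurable fun z : Fin 2 → ℂ => (toBallMat d.τ₀ d.C γ *ᵥ lift3 z) i := by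
    intro i
    simp only [Matrix.mulVec, dotProduct, lift3]
    fun_prop
  exact (h1 _).div (h1 2)

/-- The identity acts trivially. -/
theorem act_one (z : Fin 2 → ℂ) : d.act 1 z = z := by
  have hdet : IsUnit d.C.det := (Matrix.isUnit_iff_isUnit_det d.C).mp d.hC.1
  have h1 : toBallMat d.τ₀ d.C 1 = 1 := by
    unfold toBallMat
    rw [Matrix.map_one _ (map_zero _) (map_one _), Matrix.mul_one, Matrix.nonsing_inv_mul d.C hdet]
  unfold TargetData.act
  rw [h1, actM_one']

/-- The transversal: the points of the ball that are lexicographically least in their `Γ′`-orbit. -/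
def dom (Γ' : Set (Matrix (Fin 3) (Fin 3) E)) : Set (Fin 2 → ℂ) :=
  {z | z ∈ ball ∧ ∀ γ ∈ Γ', key z ≤ key (d.act γ z)}

/-- The transversal lies in the ball. -/
theorem dom_subset_ball (Γ' : Set (Matrix (Fin 3) (Fin 3) E)) : dom d Γ' ⊆ ball := fun _ hz => hz.1

/-- The transversal is measurable (a countable intersection of measurable sets). -/
theorem measurableSet_dom {Γ' : Set (Matrix (Fin 3) (Fin 3) E)} (hΓ' : Γ' ⊆ d.Γ) : MeasurableSet (dom d Γ') := by
  have hc : Γ'.Countable := (countable_Γ d).mono hΓ'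
  have : dom d Γ' = ball ∩ ⋂ γ ∈ Γ', {z | key z ≤ key (d.act γ z)} := by
    ext z
    simp only [dom, Set.mem_setOf_eq, Set.mem_inter_iff, Set.mem_iInter]
  rw [this]
  exact isOpen_ball.measurableSet.inter (MeasurableSet.biInter hc fun γ _ => measurableSet_key_le (measurable_act d γ))

/-- **Proper discontinuity**: only finitely many `γ ∈ Γ′` move `z` to a point no further from the origin. -/
theorem finite_nsq_le {Γ' : Set (Matrix (Fin 3) (Fin 3) E)} (hΓ' : Γ' ⊆ d.Γ) {z : Fin 2 → ℂ} (hz : z ∈ ball) :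
    {γ | γ ∈ Γ' ∧ nsq (d.act γ z) ≤ nsq z}.Finite := by
  set t : ℝ := Real.sqrt (nsq z) with ht
  have ht0 : 0 ≤ t := Real.sqrt_nonneg _
  have ht1 : t < 1 := by
    rw [ht, Real.sqrt_lt' one_pos, one_pow]
    exact hz
  have htt : nsq z = t ^ 2 := by rw [ht, Real.sq_sqrt (nsq_nonneg z)]
  refine (finite_bounded_part d (1 / ((1 - t) * Real.sqrt (1 - t ^ 2)))).subset ?_
  rintro γ ⟨hγ, hle⟩
  refine ⟨hΓ' hγ, fun i j => ?_⟩
  have hM := d.toBallMat_mem_U21 (hΓ' hγ)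
  exact norm_entry_le_of_mem_ball hM hz ht0 ht1 htt.le (by rw [← htt]; exact hle) i j

/-- **Every point of the ball has a translate in the transversal.** -/
theorem exists_act_mem_dom {Γ' : Set (Matrix (Fin 3) (Fin 3) E)} (hΓ' : d.IsLevel Γ') {z : Fin 2 → ℂ}
    (hz : z ∈ ball) : ∃ γ ∈ Γ', d.act γ z ∈ dom d Γ' := by
  have hcong : IsCongruenceSubgroup (conjE E) d.H Γ' := hΓ'.1
  have hfin := finite_nsq_le d hΓ'.2 hz
  have hne : hfin.toFinset.Nonempty := ⟨1, by
    rw [Set.Finite.mem_toFinset]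
    exact ⟨hcong.one_mem, by rw [act_one]⟩⟩
  obtain ⟨γ₀, hγ₀, hmin⟩ := hfin.toFinset.exists_min_image (fun γ => key (d.act γ z)) hne
  rw [Set.Finite.mem_toFinset] at hγ₀
  obtain ⟨hγ₀Γ, hγ₀le⟩ := hγ₀
  refine ⟨γ₀, hγ₀Γ, d.act_mem_ball (hΓ'.2 hγ₀Γ) hz, fun δ hδ => ?_⟩
  have hmul : d.act δ (d.act γ₀ z) = d.act (δ * γ₀) z := (d.act_mul (d.isUnitaryOf_of_mem (hΓ'.2 hγ₀Γ)) hz).symm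
  rw [hmul]
  by_cases hcase : nsq (d.act (δ * γ₀) z) ≤ nsq z
  · exact hmin (δ * γ₀) (by rw [Set.Finite.mem_toFinset]; exact ⟨hcong.mul_mem hδ hγ₀Γ, hcase⟩)
  · exact (key_lt_of_nsq_lt (lt_of_le_of_lt hγ₀le (lt_of_not_ge hcase))).le

/-- Two points of the transversal in the same `Γ′`-orbit coincide. -/
theorem eq_of_mem_dom_of_act {Γ' : Set (Matrix (Fin 3) (Fin 3) E)} (hΓ' : d.IsLevel Γ') {x y : Fin 2 → ℂ}
    (hx : x ∈ dom d Γ') (hy : y ∈ dom d Γ') {δ : Matrix (Fin 3) (Fin 3) E} (hδ : δ ∈ Γ') (hxy : y = d.act δ x) :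
    x = y := by
  have hcong : IsCongruenceSubgroup (conjE E) d.H Γ' := hΓ'.1
  obtain ⟨δ', hδ', _, hδ'δ⟩ := hcong.exists_inv hδ
  have h1 : key x ≤ key y := by rw [hxy]; exact hx.2 δ hδ
  have h2 : key y ≤ key x := by
    have := hy.2 δ' hδ'
    rw [hxy, ← d.act_mul (d.isUnitaryOf_of_mem (hΓ'.2 hδ)) hx.1, hδ'δ, act_one] at this
    rw [hxy]
    exact this
  exact key_injective (le_antisymm h1 h2)

end Transversal

/-! ## F. Assembly: the transversal is a measurable fundamental domain -/

section Assembly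

variable {F E : Type} [Field F] [NumberField F] [IsGalois ℚ F] [IsCMField F]
  [Field E] [NumberField E] [IsGalois ℚ E] [IsCMField E] (d : TargetData F E)

/-- If the ball matrix of `γ₂' γ₁` is scalar (`γ₂ γ₂' = 1`), the actions of `γ₁` and `γ₂` coincide on all of `ℂ²`. -/
theorem act_eq_of_scalar {γ₁ γ₂ γ₂' : Matrix (Fin 3) (Fin 3) E} (hinv : γ₂ * γ₂' = 1) {c : ℂ}
    (hc : toBallMat d.τ₀ d.C (γ₂' * γ₁) = Matrix.scalar (Fin 3) c)
    (hU : (toBallMat d.τ₀ d.C (γ₂' * γ₁))ᴴ * J * toBallMat d.τ₀ d.C (γ₂' * γ₁) = J) :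
    d.act γ₁ = d.act γ₂ := by
  have hc0 : c ≠ 0 := by
    have h1 := one_le_norm_two_two_of_U21 hU
    rw [hc] at h1
    simp only [Matrix.scalar_apply, Matrix.diagonal_apply_eq] at h1
    intro h0
    rw [h0, norm_zero] at h1
    linarith
  have hγ₁ : γ₁ = γ₂ * (γ₂' * γ₁) := by rw [← Matrix.mul_assoc, hinv, Matrix.one_mul]
  unfold TargetData.act
  rw [hγ₁, toBallMat_mul d.τ₀ d.hC.1, hc, scalar_eq_smul_one, Matrix.mul_smul, Matrix.mul_one, actM_smul hc0]

/-- **Almost-disjointness**: the images of the transversal under two DIFFERENT actions of `Γ′` meet in a null set. -/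
theorem volume_image_inter_image {Γ' : Set (Matrix (Fin 3) (Fin 3) E)} (hΓ' : d.IsLevel Γ')
    {γ₁ γ₂ : Matrix (Fin 3) (Fin 3) E} (h₁ : γ₁ ∈ Γ') (h₂ : γ₂ ∈ Γ') (hne : d.act γ₁ ≠ d.act γ₂) :
    volume (d.act γ₁ '' dom d Γ' ∩ d.act γ₂ '' dom d Γ') = 0 := by
  have hcong : IsCongruenceSubgroup (conjE E) d.H Γ' := hΓ'.1
  obtain ⟨γ₂', hγ₂', hγ₂γ₂', hγ₂'γ₂⟩ := hcong.exists_inv h₂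
  have hδ : γ₂' * γ₁ ∈ Γ' := hcong.mul_mem hγ₂' h₁
  have hN : (toBallMat d.τ₀ d.C (γ₂' * γ₁))ᴴ * J * toBallMat d.τ₀ d.C (γ₂' * γ₁) = J :=
    d.toBallMat_mem_U21 (hΓ'.2 hδ)
  have hns : ∀ c : ℂ, toBallMat d.τ₀ d.C (γ₂' * γ₁) ≠ Matrix.scalar (Fin 3) c :=
    fun c hc => hne (act_eq_of_scalar d hγ₂γ₂' hc hN)
  have hFx : volume {x : Fin 2 → ℂ | x ∈ ball ∧ actM (toBallMat d.τ₀ d.C (γ₂' * γ₁)) x = x} = 0 :=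
    volume_fixed_null hN hns
  have hsub : {x : Fin 2 → ℂ | x ∈ ball ∧ actM (toBallMat d.τ₀ d.C (γ₂' * γ₁)) x = x} ⊆ ball :=
    fun _ hx => hx.1
  have himg : volume (d.act γ₁ '' {x : Fin 2 → ℂ | x ∈ ball ∧ actM (toBallMat d.τ₀ d.C (γ₂' * γ₁)) x = x}) = 0 :=
    addHaar_image_eq_zero_of_differentiableOn_of_addHaar_eq_zero volume
      (((d.differentiableOn_act (hΓ'.2 h₁)).restrictScalars ℝ).mono hsub) hFx
  refine measure_mono_null ?_ himg
  rintro w ⟨⟨x, hx, rfl⟩, ⟨y, hy, hyx⟩⟩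
  have hyδ : y = d.act (γ₂' * γ₁) x := by
    have h := congrArg (d.act γ₂') hyx
    rw [← d.act_mul (d.isUnitaryOf_of_mem (hΓ'.2 h₂)) hy.1, hγ₂'γ₂, act_one,
      ← d.act_mul (d.isUnitaryOf_of_mem (hΓ'.2 h₁)) hx.1] at h
    exact h
  have hxy : x = y := eq_of_mem_dom_of_act d hΓ' hx hy hδ hyδ
  refine ⟨x, ⟨hx.1, ?_⟩, rfl⟩
  show d.act (γ₂' * γ₁) x = x
  rw [← hyδ, hxy]

/-- **Every level `Γ′` has a measurable fundamental domain in the ball**, in the sense of the frozen target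
(`IsFundamentalDomainFor`): the lexicographically least points of the orbits. -/
theorem exists_fundamentalDomain {Γ' : Set (Matrix (Fin 3) (Fin 3) E)} (hΓ' : d.IsLevel Γ') :
    ∃ D : Set (Fin 2 → ℂ), IsFundamentalDomainFor (ballActions d.τ₀ d.C Γ') D := by
  refine ⟨dom d Γ', measurableSet_dom d hΓ'.2, dom_subset_ball d Γ', ?_, ?_⟩
  · refine ae_restrict_of_forall_mem isOpen_ball.measurableSet fun z hz => ?_
    obtain ⟨γ, hγ, hmem⟩ := exists_act_mem_dom d hΓ' hz
    exact ⟨actM (toBallMat d.τ₀ d.C γ), ⟨γ, hγ, rfl⟩, hmem⟩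
  · rintro φ ⟨γ₁, h₁, rfl⟩ ψ ⟨γ₂, h₂, rfl⟩ hne
    exact volume_image_inter_image d hΓ' h₁ h₂ hne

/-- **`exists_domain`**: every level of the datum has a fundamental domain (`d.IsDomain Γ′ D`). -/
theorem TargetData.exists_domain (Γ' : Set (Matrix (Fin 3) (Fin 3) E)) (hΓ' : d.IsLevel Γ') :
    ∃ D : Set (Fin 2 → ℂ), d.IsDomain Γ' D :=
  exists_fundamentalDomain d hΓ'

end Assembly

end Summit.Ventures.HodgeRepro.Tier4

end

#print axioms Summit.Ventures.HodgeRepro.Tier4.finite_bounded_part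
#print axioms Summit.Ventures.HodgeRepro.Tier4.exists_fundamentalDomain
#print axioms Summit.Ventures.HodgeRepro.Tier4.TargetData.exists_domain
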